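import Literature.Probability.RandomPlanarGeometry.HexSAWBrickWallStripFugacityWidthOneContactDensity
import HarnessLib

/-!
# The two-wall chart of the strip self-avoiding walk: wall coordinates, the inverse equation of state, the repelling corner

For the `N`-step self-avoiding walk of the one-cell honeycomb (brick-wall) strip `S_1` under the two-wall weights `y^{bc} z^{tc}`
(`C_{1,N}(y,z)`, BBdGDCG2014 §3.2), the tree knows the growth rate `μ_1(y,z)` through the SEXTIC LAW `s(s−y)(s−z) = yz`, `s = μ_1²`
(`stripMuY₂_one_sq_poly_eq`), the contact densities `b(y,z) = s(s−z)/(2F(s))`, `b_top = b(z,y)` (`contactB`, laws of large numbers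
in `…WidthOneContactDensity`), and the rung density `ρ(y,z) = 1/M(y,z)` (`twoWallRho`, `…WidthOneSpeed`).  THIS FILE introduces the
WALL COORDINATES `α = y/s`, `β = z/s ∈ (0,1)` and shows that they LINEARISE the model:

* the sextic law becomes `s(1−α)(1−β) = αβ`, so `(y,z) ↦ (α,β)` is a BIJECTION `(0,∞)² → (0,1)²` with the rational inverse
  `y = α²β/((1−α)(1−β))`, `z = αβ²/((1−α)(1−β))`, `s = αβ/((1−α)(1−β))` (§3);
* `ρ = (1−α)(1−β)/D`, `b = (1−β)/(2D)`, `b_top = (1−α)/(2D)`, `D = 3 − 2α − 2β + αβ` (§2), whence the RATIO LAW `ρ = 2b(s−y)/s`;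
* ★★★ the INVERSE EQUATION OF STATE (§4): `y = (4b+2b_top−1)²(2b+4b_top−1)/(2b(1−2b−2b_top)²)` (and `z` symmetrically), the map
  `(y,z) ↦ (b, b_top)` is a bijection from `(0,∞)²` onto the open DENSITY TRIANGLE `{b + b_top < 1/2, 4b + 2b_top > 1, 2b + 4b_top > 1}`
  (vertices `(1/6,1/6)`, `(1/2,0)`, `(0,1/2)`), and `μ_1² = (4b+2b_top−1)(2b+4b_top−1)/ρ²` (on the diagonal `μ_1 = (6b−1)/(1−4b)`);
* the REPELLING CORNER `(y,z) → (0⁺,0⁺)` (§5): `ρ(y,z)·y(y−z) < z` (domination), `0 < 1/ρ − 3 ≤ q₁/(1−q₁) + q₂/(1−q₂)` whenever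
  `y² ≤ q₁³z`, `z² ≤ q₂³y` (so `ρ → 1/3` iff-type criterion `y² ≪ z`, `z² ≪ y`), the exact PARABOLA SCALING `z = c y²`
  (`σ = s/y` solves `σ(σ−1)(σ−cy) = c`; `ρ → (σ₀−1)/(3σ₀−2)` for `c = σ₀²(σ₀−1)`), hence EVERY `r ∈ [0,1/3]` is a corner limit
  (`r ∈ (0,1/3)` along exactly the parabola `c_r = r(1−2r)²/(1−3r)³`) and `ρ` has NO limit at the corner: the threshold exponent is `2`.

## Main statements (namespace `Literature.Probability.RandomPlanarGeometry.SAW.HexBW`, all PROVED, standard axioms)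

§1 `wallA` (`α(y,z) = y/μ_1(y,z)²`; `β = wallA z y`), `wallA_swap`, `wallA_facts` (`0 < α, β < 1`, `1 − α = (s−y)/s`, `s(1−α)(1−β) = αβ`).
§2 `twoWallM_eq_wallA`, ★ `twoWallRho_eq_wallA`, ★ `contactB_eq_wallA`, ★★ `twoWallRho_eq_two_mul_contactB` (RATIO LAW `ρ = 2b·(s−y)/s = 2b_top·(s−z)/s`).
§3 `chartY` (`Y(α,β) = α²β/((1−α)(1−β))`), ★★ `chartY_wallA` (`Y(α,β) = y`, `Y(β,α) = z`, `μ_1² = αβ/((1−α)(1−β))`),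
★★ `wallA_chartY` (every `(α,β) ∈ (0,1)²` is realised: `μ_1(Y(α,β),Y(β,α))² = αβ/((1−α)(1−β))` by root uniqueness, wall coordinates `α, β`).
§4 `eosY`, `contactB_affine_eq_wallA`, ★★ `contactB_mem_triangle`, ★★★ **`eosY_contactB`** (the inverse equation of state),
★★★ **`contactB_eosY`** (every point of the triangle is realised by the explicit fugacities, with `ρ = 1 − 2a − 2a'` and
`μ_1² = (4a+2a'−1)(2a+4a'−1)/(1−2a−2a')²`), ★★ `eq_of_contactB_eq` (uniqueness), ★★ `stripMuY₂_one_sq_eq_of_contactB`,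
★ `stripMuY₂_one_self_eq_of_contactB` (`μ_1(y,y) = (6b−1)/(1−4b)`, `b(y,y) ∈ (1/6,1/4)`).
§5 ★★ `twoWallRho_lt_gap` (DOMINATION `ρ < (s−y)/s`, `ρ < (s−z)/s`, `z < y ⇒ ρ·y(y−z) < z`), `inv_twoWallRho_eq` (`1/ρ = 3 + α/(1−α) + β/(1−β)`,
`α³z ≤ y²`, `β³y ≤ z²`), ★★ `inv_twoWallRho_sub_three_le` (quantitative one-third criterion), ★★ `tendsto_twoWallRho_one_third` (filter form),
★ `tendsto_twoWallRho_self_nhdsGT_zero` (`ρ(y,y) → 1/3`), `sigma_parabola_facts`, `sigma_parabola_sandwich` (`σ₀ < σ ≤ σ₀ + c²y/(σ₀²(1−cy))`),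
★★ `tendsto_sigma_parabola`, ★★★ **`tendsto_twoWallRho_parabola'`** / **`tendsto_twoWallRho_parabola`** (`ρ(y, c_r y²) → r`, every `r ∈ (0,1/3)`),
★★ **`exists_path_tendsto_twoWallRho`** (cluster set `[0,1/3]`), ★★ **`not_tendsto_twoWallRho_corner`** (no limit at `(0⁺,0⁺)`).

## Sources, what is printed, what is not

BeatonBousquetMelouDeGierDuminilCopinGuttmann2014 §3.2 Proposition 6 (arXiv:1109.0358v5 p. 10; held chunk p0008) prints ONLY: `μ_T(y,z)`
exists, is finite, non-decreasing in `y` and `z`, symmetric, and `μ_T(1,y)` is log-convex in `log y`.  The width-one closed forms (sextic law,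
`b`, `ρ`, the two laws of large numbers) are this lineage's tree theorems (#536, #555, a-p5 g20/g21); MadrasSlade1993 §1.1 (1.1.5) / §1.2 is the
frame for `μ` and elementary monotonicity; DemboZeitouni2010 §2.3 Definition 2.3.3 (exposed points of `Λ*`) is the notion that `contactB_eosY`
makes explicit in two variables — every interior density pair is exposed, with the tilt written in closed form.  LOCATOR GLOSS carried for the
parent `HexSAWBrickWallStripFugacityWidthOneContactLDP.lean` l. 677 (`exists_gt_contactB_eq`): its docstring's «Lemma 2.2.5 (the exposed points
of Λ*)» should read «Definition 2.3.3» (exposed points are defined in §2.3; Lemma 2.2.5 is the monotonicity/differentiability of `Λ*` on `ℝ`) —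
cell referee's gloss of 2026-08-27, to be applied in that module's next theorem-bearing edition.  Nothing here is quoted AS PRINTED; no source
in our holdings inverts a two-fugacity equation of state of a strip walk or describes the corner path-dependence — both are this lineage's.
NOT CLAIMED: joint continuity of `(y,z) ↦ (α,β)` as a homeomorphism statement, the level curves of `ρ` away from the corner, the
attracting corner `(∞,∞)` (covered along rays by `HexSAWBrickWallStripRungRays` §6–§7), widths `T ≥ 2`.
-/

noncomputable section

open Filter Topology Finset Literature.Probability.LatticeModels Literature.Probability.Percolation SimpleGraph

namespace Literature.Probability.RandomPlanarGeometry.SAW.HexBW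

open WidthOneYZ

variable {y z : ℝ}

/-! ## §1 Wall coordinates `α = y/μ_1(y,z)²`, `β = z/μ_1(y,z)²` -/

/-- The WALL COORDINATE `α(y,z) = y/s`, `s = μ_1(y,z)²` (the bottom fugacity measured in units of the squared growth rate); the top
coordinate is `β(y,z) = α(z,y) = z/s` (`wallA_swap`). [cite: BeatonBousquetMelouDeGierDuminilCopinGuttmann2014, §3.2 Proposition 6 (arXiv v5 p. 10)] -/
def wallA (y z : ℝ) : ℝ := y / stripMuY₂ 1 y z ^ 2

/-- `β(y,z) := α(z,y) = z/μ_1(y,z)²` (symmetry `μ_1(z,y) = μ_1(y,z)`). [cite: BeatonBousquetMelouDeGierDuminilCopinGuttmann2014, §3.2 Proposition 6 (arXiv v5 p. 10: μ_T(y,z) = μ_T(z,y))] -/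
theorem wallA_swap (y z : ℝ) : wallA z y = z / stripMuY₂ 1 y z ^ 2 := by
  unfold wallA; rw [stripMuY₂_symm]

/-- Basic facts: `0 < α < 1`, `0 < β < 1`, `1 − α = (s − y)/s`, `1 − β = (s − z)/s`, and the SEXTIC LAW in wall coordinates
`s·(1 − α)(1 − β) = αβ` (i.e. `(s − y)(s − z)/s = yz/s²`).
[cite: BeatonBousquetMelouDeGierDuminilCopinGuttmann2014, §3.2 Proposition 6 (arXiv v5 p. 10)] -/
theorem wallA_facts (hy : 0 < y) (hz : 0 < z) :
    0 < wallA y z ∧ wallA y z < 1 ∧ 0 < wallA z y ∧ wallA z y < 1 ∧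
      1 - wallA y z = (stripMuY₂ 1 y z ^ 2 - y) / stripMuY₂ 1 y z ^ 2 ∧
      1 - wallA z y = (stripMuY₂ 1 y z ^ 2 - z) / stripMuY₂ 1 y z ^ 2 ∧
      stripMuY₂ 1 y z ^ 2 * ((1 - wallA y z) * (1 - wallA z y)) = wallA y z * wallA z y := by
  obtain ⟨hys, hzs⟩ := lt_stripMuY₂_one_sq₂ hy hz
  have hsex := stripMuY₂_one_sq_poly_eq hy hz
  rw [wallA_swap y z]
  unfold wallA
  set s := stripMuY₂ 1 y z ^ 2 with hs
  have hs0 : 0 < s := hy.trans hys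
  have hs1 : s ≠ 0 := hs0.ne'
  refine ⟨div_pos hy hs0, (div_lt_one hs0).2 hys, div_pos hz hs0, (div_lt_one hs0).2 hzs, ?_, ?_, ?_⟩
  · field_simp
  · field_simp
  · have e : s * ((1 - y / s) * (1 - z / s)) = s * (s - y) * (s - z) / s ^ 2 := by field_simp
    rw [e, hsex, div_mul_div_comm, pow_two]

/-! ## §2 The observables in wall coordinates: `ρ`, `b`, `b_top` are rational in `(α, β)` -/

/-- The reciprocal rung density in wall coordinates: `M(y,z) = 1/ρ(y,z) = 3 + α/(1−α) + β/(1−β)` (this is the tree's `twoWallM` read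
through `y·x₀² = α`, `z·x₀² = β`, `x₀ = 1/μ_1`). [cite: BeatonBousquetMelouDeGierDuminilCopinGuttmann2014, §3.2 Proposition 6 (arXiv v5 p. 10)] -/
theorem twoWallM_eq_wallA (y z : ℝ) :
    twoWallM y z = 3 + wallA y z / (1 - wallA y z) + wallA z y / (1 - wallA z y) := by
  unfold twoWallM
  rw [wallA_swap y z]
  unfold wallA
  rw [inv_pow, ← div_eq_mul_inv, ← div_eq_mul_inv]

/-- ★ **THE RUNG DENSITY IN WALL COORDINATES**: `ρ(y,z) = (1−α)(1−β) / (3 − 2α − 2β + αβ)` for all `y, z > 0`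
(`3 − 2α − 2β + αβ = (1−α)(1−β) + (1−α) + (1−β) > 0`). [cite: BeatonBousquetMelouDeGierDuminilCopinGuttmann2014, §3.2 Proposition 6 (arXiv v5 p. 10); MadrasSlade1993, §1.1 eq. (1.1.5)] -/
theorem twoWallRho_eq_wallA (hy : 0 < y) (hz : 0 < z) :
    twoWallRho y z = (1 - wallA y z) * (1 - wallA z y) / (3 - 2 * wallA y z - 2 * wallA z y + wallA y z * wallA z y) := by
  obtain ⟨-, ha1, -, hb1, -⟩ := wallA_facts hy hz
  unfold twoWallRho
  rw [twoWallM_eq_wallA]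
  set a := wallA y z
  set b := wallA z y
  have ha : (1 - a) ≠ 0 := by linarith
  have hb : (1 - b) ≠ 0 := by linarith
  have hD : 3 - 2 * a - 2 * b + a * b ≠ 0 := by nlinarith [mul_pos (sub_pos.2 ha1) (sub_pos.2 hb1)]
  field_simp
  ring

/-- ★ **THE CONTACT DENSITIES IN WALL COORDINATES**: `b(y,z) = (1−β)/(2(3 − 2α − 2β + αβ))` and `b_top(y,z) = b(z,y) = (1−α)/(2(3 − 2α − 2β + αβ))`
— each wall's density is proportional to the OTHER wall's gap `1 − β = (s−z)/s`, resp. `1 − α = (s−y)/s`.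
[cite: BeatonBousquetMelouDeGierDuminilCopinGuttmann2014, §3.2 Proposition 6 (arXiv v5 p. 10); MadrasSlade1993, §1.2 (elementary)] -/
theorem contactB_eq_wallA (hy : 0 < y) (hz : 0 < z) :
    contactB y z = (1 - wallA z y) / (2 * (3 - 2 * wallA y z - 2 * wallA z y + wallA y z * wallA z y)) ∧
      contactB z y = (1 - wallA y z) / (2 * (3 - 2 * wallA y z - 2 * wallA z y + wallA y z * wallA z y)) := by
  obtain ⟨hys, hzs, hF, -, -⟩ := contactB_facts hy hz
  rw [contactB_swap y z]
  unfold contactB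
  rw [wallA_swap y z]
  unfold wallA sexticDeriv at *
  set s := stripMuY₂ 1 y z ^ 2 with hs
  have hs0 : 0 < s := hy.trans hys
  have hD : 0 < 3 - 2 * (y / s) - 2 * (z / s) + y / s * (z / s) := by
    have e : 3 - 2 * (y / s) - 2 * (z / s) + y / s * (z / s) = ((s - y) * (s - z) + s * (s - z) + s * (s - y)) / s ^ 2 := by
      field_simp; ring
    rw [e]; positivity
  constructor
  · rw [div_eq_div_iff (by positivity) (by positivity)]
    field_simp
    ring
  · rw [div_eq_div_iff (by positivity) (by positivity)]
    field_simp
    ring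

/-- ★★ **THE RATIO LAW**: `ρ(y,z) = 2·b(y,z)·(1 − α) = 2·b(y,z)·(s − y)/s` and `ρ(y,z) = 2·b_top(y,z)·(s − z)/s` — the rung density is
twice a wall's contact density times the RELATIVE GAP of that same wall. [cite: BeatonBousquetMelouDeGierDuminilCopinGuttmann2014, §3.2 Proposition 6 (arXiv v5 p. 10); MadrasSlade1993, §1.1 eq. (1.1.5)] -/
theorem twoWallRho_eq_two_mul_contactB (hy : 0 < y) (hz : 0 < z) :
    twoWallRho y z = 2 * contactB y z * ((stripMuY₂ 1 y z ^ 2 - y) / stripMuY₂ 1 y z ^ 2) ∧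
      twoWallRho y z = 2 * contactB z y * ((stripMuY₂ 1 y z ^ 2 - z) / stripMuY₂ 1 y z ^ 2) := by
  obtain ⟨ha0, ha1, hb0, hb1, h1a, h1b, -⟩ := wallA_facts hy hz
  obtain ⟨hb, hb'⟩ := contactB_eq_wallA hy hz
  rw [twoWallRho_eq_wallA hy hz, hb, hb', ← h1a, ← h1b]
  set a := wallA y z
  set b := wallA z y
  have hD : 3 - 2 * a - 2 * b + a * b ≠ 0 := by nlinarith [mul_pos (sub_pos.2 ha1) (sub_pos.2 hb1)]
  constructor
  · field_simp
  · field_simp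

/-! ## §3 The chart `(y,z) ↦ (α,β)` is a bijection `(0,∞)² → (0,1)²` with the rational inverse `(α,β) ↦ (α²β, αβ²)/((1−α)(1−β))` -/

/-- The inverse chart: `Y(α,β) = α²β/((1−α)(1−β))`; the companion fugacity is `Z(α,β) = Y(β,α) = αβ²/((1−α)(1−β))` and the squared growth
rate is `S(α,β) = αβ/((1−α)(1−β))` (`Y = αS`, `Z = βS`). [cite: BeatonBousquetMelouDeGierDuminilCopinGuttmann2014, §3.2 Proposition 6 (arXiv v5 p. 10)] -/
def chartY (α β : ℝ) : ℝ := α ^ 2 * β / ((1 - α) * (1 - β))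

/-- ★★ **The chart inverts the wall coordinates**: `Y(α(y,z), β(y,z)) = y` and `Y(β(y,z), α(y,z)) = z` for all `y, z > 0`
(`α²β/((1−α)(1−β)) = y²z/(s(s−y)(s−z)) = y²z/(yz) = y` by the sextic law); and `μ_1(y,z)² = αβ/((1−α)(1−β))`.
[cite: BeatonBousquetMelouDeGierDuminilCopinGuttmann2014, §3.2 Proposition 6 (arXiv v5 p. 10)] -/
theorem chartY_wallA (hy : 0 < y) (hz : 0 < z) :
    chartY (wallA y z) (wallA z y) = y ∧ chartY (wallA z y) (wallA y z) = z ∧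
      stripMuY₂ 1 y z ^ 2 = wallA y z * wallA z y / ((1 - wallA y z) * (1 - wallA z y)) := by
  obtain ⟨ha0, ha1, hb0, hb1, h1a, h1b, hkey⟩ := wallA_facts hy hz
  obtain ⟨hys, hzs⟩ := lt_stripMuY₂_one_sq₂ hy hz
  have hsex := stripMuY₂_one_sq_poly_eq hy hz
  have hμ : stripMuY₂ 1 y z ≠ 0 := (stripMuY₂_pos 1 hy hz).ne'
  have hαs : wallA y z * stripMuY₂ 1 y z ^ 2 = y := by
    unfold wallA; field_simp
  have hβs : wallA z y * stripMuY₂ 1 y z ^ 2 = z := by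
    rw [wallA_swap y z]; field_simp
  set s := stripMuY₂ 1 y z ^ 2 with hs
  set a := wallA y z
  set b := wallA z y
  have hs0 : 0 < s := hy.trans hys
  have hgap : 0 < (1 - a) * (1 - b) := mul_pos (sub_pos.2 ha1) (sub_pos.2 hb1)
  -- `(1−a)(1−b) = ab/s`... from `hkey : s * ((1-a)(1-b)) = a b s`
  have hS : s = a * b / ((1 - a) * (1 - b)) := by
    rw [eq_div_iff hgap.ne']
    exact hkey
  unfold chartY
  refine ⟨?_, ?_, hS⟩
  · calc a ^ 2 * b / ((1 - a) * (1 - b)) = a * (a * b / ((1 - a) * (1 - b))) := by ring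
      _ = a * s := by rw [← hS]
      _ = y := hαs
  · calc b ^ 2 * a / ((1 - b) * (1 - a)) = b * (a * b / ((1 - a) * (1 - b))) := by ring
      _ = b * s := by rw [← hS]
      _ = z := hβs

/-- ★★ **Every point of the open unit square is a pair of wall coordinates**: for `0 < α, β < 1`, the fugacities
`y = α²β/((1−α)(1−β))`, `z = αβ²/((1−α)(1−β))` are positive, have growth rate `μ_1(y,z)² = αβ/((1−α)(1−β))` (the unique root of the
sextic above `max(y,z)`), and wall coordinates `α(y,z) = α`, `β(y,z) = β`.  With `chartY_wallA`: `(y,z) ↦ (α,β)` is a BIJECTION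
`(0,∞)² → (0,1)²`. [cite: BeatonBousquetMelouDeGierDuminilCopinGuttmann2014, §3.2 Proposition 6 (arXiv v5 p. 10)] -/
theorem wallA_chartY {α β : ℝ} (hα0 : 0 < α) (hα1 : α < 1) (hβ0 : 0 < β) (hβ1 : β < 1) :
    0 < chartY α β ∧ 0 < chartY β α ∧
      stripMuY₂ 1 (chartY α β) (chartY β α) ^ 2 = α * β / ((1 - α) * (1 - β)) ∧
      wallA (chartY α β) (chartY β α) = α ∧ wallA (chartY β α) (chartY α β) = β := by
  have h1α : 0 < 1 - α := sub_pos.2 hα1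
  have h1β : 0 < 1 - β := sub_pos.2 hβ1
  set S := α * β / ((1 - α) * (1 - β)) with hS
  have hS0 : 0 < S := by positivity
  have hY : chartY α β = α * S := by rw [hS]; unfold chartY; field_simp
  have hZ : chartY β α = β * S := by rw [hS]; unfold chartY; field_simp
  have hY0 : 0 < chartY α β := by rw [hY]; positivity
  have hZ0 : 0 < chartY β α := by rw [hZ]; positivity
  -- `S` is the root above `max(Y,Z)`
  have hroot : stripMuY₂ 1 (chartY α β) (chartY β α) ^ 2 = S := by
    apply stripMuY₂_one_sq_eq_of_root hY0 hZ0
    · rw [hY, hZ]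
      refine max_le ?_ ?_ <;> nlinarith
    · rw [hY, hZ]
      have hk : S * ((1 - α) * (1 - β)) = α * β := by rw [hS]; field_simp
      have e : S * (S - α * S) * (S - β * S) = S ^ 2 * (S * ((1 - α) * (1 - β))) := by ring
      rw [e, hk]; ring
  refine ⟨hY0, hZ0, hroot, ?_, ?_⟩
  · unfold wallA; rw [hroot, hY]; field_simp
  · rw [wallA_swap (chartY α β) (chartY β α), hroot, hZ]; field_simp

/-! ## §4 The inverse equation of state: the fugacities as RATIONAL functions of the two contact densities; the density triangle -/

/-- **The inverse equation of state**: `Y(a,a') = (4a + 2a' − 1)²·(2a + 4a' − 1) / (2a·(1 − 2a − 2a')²)` — the bottom fugacity that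
produces bottom contact density `a` and top contact density `a'`; the top fugacity is `Y(a',a)`.
[cite: BeatonBousquetMelouDeGierDuminilCopinGuttmann2014, §3.2 Proposition 6 (arXiv v5 p. 10); MadrasSlade1993, §1.2 (elementary)] -/
def eosY (a a' : ℝ) : ℝ := (4 * a + 2 * a' - 1) ^ 2 * (2 * a + 4 * a' - 1) / (2 * a * (1 - 2 * a - 2 * a') ^ 2)

/-- The three affine forms of the densities in wall coordinates: `4b + 2b_top − 1 = α(1−β)/D`, `2b + 4b_top − 1 = β(1−α)/D`,
`1 − 2b − 2b_top = ρ = (1−α)(1−β)/D`, `D = 3 − 2α − 2β + αβ`. [cite: BeatonBousquetMelouDeGierDuminilCopinGuttmann2014, §3.2 Proposition 6 (arXiv v5 p. 10)] -/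
theorem contactB_affine_eq_wallA (hy : 0 < y) (hz : 0 < z) :
    4 * contactB y z + 2 * contactB z y - 1 =
        wallA y z * (1 - wallA z y) / (3 - 2 * wallA y z - 2 * wallA z y + wallA y z * wallA z y) ∧
      2 * contactB y z + 4 * contactB z y - 1 =
        wallA z y * (1 - wallA y z) / (3 - 2 * wallA y z - 2 * wallA z y + wallA y z * wallA z y) ∧
      1 - 2 * contactB y z - 2 * contactB z y =
        (1 - wallA y z) * (1 - wallA z y) / (3 - 2 * wallA y z - 2 * wallA z y + wallA y z * wallA z y) ∧
      1 - 2 * contactB y z - 2 * contactB z y = twoWallRho y z := by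
  obtain ⟨ha0, ha1, hb0, hb1, -⟩ := wallA_facts hy hz
  obtain ⟨hb, hb'⟩ := contactB_eq_wallA hy hz
  rw [twoWallRho_eq_wallA hy hz, hb, hb']
  set a := wallA y z
  set b := wallA z y
  have hD0 : 0 < 3 - 2 * a - 2 * b + a * b := by nlinarith [mul_pos (sub_pos.2 ha1) (sub_pos.2 hb1)]
  set D := 3 - 2 * a - 2 * b + a * b with hDdef
  have hD : D ≠ 0 := hD0.ne'
  refine ⟨?_, ?_, ?_, ?_⟩
  · rw [eq_div_iff hD]; field_simp; rw [hDdef]; ring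
  · rw [eq_div_iff hD]; field_simp; rw [hDdef]; ring
  · rw [eq_div_iff hD]; field_simp; rw [hDdef]; ring
  · field_simp; rw [hDdef]; ring

/-- ★★ **THE DENSITY TRIANGLE**: for all `y, z > 0` the pair `(b, b_top) = (b(y,z), b(z,y))` lies in the OPEN TRIANGLE
`b + b_top < 1/2`, `4b + 2b_top > 1`, `2b + 4b_top > 1` (vertices `(1/6,1/6)`, `(1/2,0)`, `(0,1/2)`).
[cite: BeatonBousquetMelouDeGierDuminilCopinGuttmann2014, §3.2 Proposition 6 (arXiv v5 p. 10); MadrasSlade1993, §1.1 eq. (1.1.5)] -/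
theorem contactB_mem_triangle (hy : 0 < y) (hz : 0 < z) :
    contactB y z + contactB z y < 1 / 2 ∧ 1 < 4 * contactB y z + 2 * contactB z y ∧ 1 < 2 * contactB y z + 4 * contactB z y := by
  obtain ⟨ha0, ha1, hb0, hb1, -⟩ := wallA_facts hy hz
  obtain ⟨h1, h2, h3, -⟩ := contactB_affine_eq_wallA hy hz
  set a := wallA y z
  set b := wallA z y
  have hD : 0 < 3 - 2 * a - 2 * b + a * b := by nlinarith [mul_pos (sub_pos.2 ha1) (sub_pos.2 hb1)]
  have e1 : 0 < a * (1 - b) / (3 - 2 * a - 2 * b + a * b) := div_pos (mul_pos ha0 (sub_pos.2 hb1)) hD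
  have e2 : 0 < b * (1 - a) / (3 - 2 * a - 2 * b + a * b) := div_pos (mul_pos hb0 (sub_pos.2 ha1)) hD
  have e3 : 0 < (1 - a) * (1 - b) / (3 - 2 * a - 2 * b + a * b) := div_pos (mul_pos (sub_pos.2 ha1) (sub_pos.2 hb1)) hD
  refine ⟨by linarith, by linarith, by linarith⟩

/-- ★★★ **THE INVERSE EQUATION OF STATE**: for all `y, z > 0`, with `b = b(y,z)`, `b_top = b(z,y)`:
`y = (4b + 2b_top − 1)²(2b + 4b_top − 1) / (2b(1 − 2b − 2b_top)²)` and `z = (2b + 4b_top − 1)²(4b + 2b_top − 1) / (2b_top(1 − 2b − 2b_top)²)` —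
the two wall fugacities are RATIONAL functions of the two contact densities (the measured densities determine the interaction).
[cite: BeatonBousquetMelouDeGierDuminilCopinGuttmann2014, §3.2 Proposition 6 (arXiv v5 p. 10); MadrasSlade1993, §1.2 (elementary)] -/
theorem eosY_contactB (hy : 0 < y) (hz : 0 < z) :
    eosY (contactB y z) (contactB z y) = y ∧ eosY (contactB z y) (contactB y z) = z := by
  obtain ⟨ha0, ha1, hb0, hb1, -⟩ := wallA_facts hy hz
  obtain ⟨h1, h2, h3, -⟩ := contactB_affine_eq_wallA hy hz
  obtain ⟨hb, hb'⟩ := contactB_eq_wallA hy hz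
  obtain ⟨hcy, hcz, -⟩ := chartY_wallA hy hz
  unfold eosY
  have e2 : 4 * contactB z y + 2 * contactB y z - 1 = 2 * contactB y z + 4 * contactB z y - 1 := by ring
  have e3 : 2 * contactB z y + 4 * contactB y z - 1 = 4 * contactB y z + 2 * contactB z y - 1 := by ring
  have e4 : 1 - 2 * contactB z y - 2 * contactB y z = 1 - 2 * contactB y z - 2 * contactB z y := by ring
  rw [e2, e3, e4, h1, h2, h3, hb, hb']
  unfold chartY at hcy hcz
  set a := wallA y z
  set b := wallA z y
  have hD0 : 0 < 3 - 2 * a - 2 * b + a * b := by nlinarith [mul_pos (sub_pos.2 ha1) (sub_pos.2 hb1)]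
  set D := 3 - 2 * a - 2 * b + a * b with hDdef
  have hD : D ≠ 0 := hD0.ne'
  have h1a : (1 - a) ≠ 0 := by linarith
  have h1b : (1 - b) ≠ 0 := by linarith
  constructor
  · rw [← hcy]
    field_simp
  · rw [← hcz]
    field_simp

/-- ★★★ **EVERY POINT OF THE DENSITY TRIANGLE IS REALISED, BY EXPLICIT FUGACITIES**: for `a, a'` with `a + a' < 1/2`, `4a + 2a' > 1`,
`2a + 4a' > 1`, the fugacities `y = Y(a,a')`, `z = Y(a',a)` (`eosY`) are positive and give EXACTLY bottom density `b(y,z) = a`, top density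
`b(z,y) = a'`, rung density `ρ(y,z) = 1 − 2a − 2a'` and growth rate `μ_1(y,z)² = (4a+2a'−1)(2a+4a'−1)/(1−2a−2a')²`.  With `eosY_contactB`:
`(y,z) ↦ (b(y,z), b(z,y))` is a BIJECTION from `(0,∞)²` onto the open triangle, with rational inverse.
[cite: BeatonBousquetMelouDeGierDuminilCopinGuttmann2014, §3.2 Proposition 6 (arXiv v5 p. 10); DemboZeitouni2010, §2.3 Definition 2.3.3 (exposed points: here every interior density pair is exposed, with an explicit tilt)] -/
theorem contactB_eosY {a a' : ℝ} (h1 : a + a' < 1 / 2) (h2 : 1 < 4 * a + 2 * a') (h3 : 1 < 2 * a + 4 * a') :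
    0 < eosY a a' ∧ 0 < eosY a' a ∧
      contactB (eosY a a') (eosY a' a) = a ∧ contactB (eosY a' a) (eosY a a') = a' ∧
      twoWallRho (eosY a a') (eosY a' a) = 1 - 2 * a - 2 * a' ∧
      stripMuY₂ 1 (eosY a a') (eosY a' a) ^ 2 = (4 * a + 2 * a' - 1) * (2 * a + 4 * a' - 1) / (1 - 2 * a - 2 * a') ^ 2 := by
  have ha : 0 < a := by linarith
  have ha' : 0 < a' := by linarith
  have hρ : 0 < 1 - 2 * a - 2 * a' := by linarith
  have ha0 : a ≠ 0 := ha.ne'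
  have ha0' : a' ≠ 0 := ha'.ne'
  have hρ0 : 1 - 2 * a - 2 * a' ≠ 0 := hρ.ne'
  set α := (4 * a + 2 * a' - 1) / (2 * a) with hα
  set β := (2 * a + 4 * a' - 1) / (2 * a') with hβ
  have hα0 : 0 < α := div_pos (by linarith) (by linarith)
  have hα1 : α < 1 := by rw [hα, div_lt_one (by linarith)]; linarith
  have hβ0 : 0 < β := div_pos (by linarith) (by linarith)
  have hβ1 : β < 1 := by rw [hβ, div_lt_one (by linarith)]; linarith
  have hY : eosY a a' = chartY α β := by
    unfold eosY chartY; rw [hα, hβ]; field_simp; ring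
  have hZ : eosY a' a = chartY β α := by
    unfold eosY chartY; rw [hα, hβ]; field_simp; ring
  obtain ⟨hY0, hZ0, hS, hwa, hwb⟩ := wallA_chartY hα0 hα1 hβ0 hβ1
  rw [hY, hZ]
  obtain ⟨hb, hb'⟩ := contactB_eq_wallA hY0 hZ0
  rw [hwa, hwb] at hb hb'
  have hDval : 3 - 2 * α - 2 * β + α * β = (1 - 2 * a - 2 * a') / (4 * a * a') := by
    rw [hα, hβ]; field_simp; ring
  have hβval : 1 - β = (1 - 2 * a - 2 * a') / (2 * a') := by rw [hβ]; field_simp; ring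
  have hαval : 1 - α = (1 - 2 * a - 2 * a') / (2 * a) := by rw [hα]; field_simp; ring
  have hbv : contactB (chartY α β) (chartY β α) = a := by
    rw [hb, hDval, hβval]; field_simp; norm_num
  have hbv' : contactB (chartY β α) (chartY α β) = a' := by
    rw [hb', hDval, hαval]; field_simp; norm_num
  refine ⟨hY0, hZ0, hbv, hbv', ?_, ?_⟩
  · rw [← (contactB_affine_eq_wallA hY0 hZ0).2.2.2, hbv, hbv']
  · rw [hS, hα, hβ]; field_simp; ring

/-- ★★ **UNIQUENESS**: two pairs of positive fugacities with the same two contact densities coincide (the inverse equation of state).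
[cite: BeatonBousquetMelouDeGierDuminilCopinGuttmann2014, §3.2 Proposition 6 (arXiv v5 p. 10)] -/
theorem eq_of_contactB_eq (hy : 0 < y) (hz : 0 < z) {y' z' : ℝ} (hy' : 0 < y') (hz' : 0 < z')
    (h₁ : contactB y z = contactB y' z') (h₂ : contactB z y = contactB z' y') : y = y' ∧ z = z' := by
  obtain ⟨e1, e2⟩ := eosY_contactB hy hz
  obtain ⟨e1', e2'⟩ := eosY_contactB hy' hz'
  exact ⟨by rw [← e1, h₁, h₂, e1'], by rw [← e2, h₁, h₂, e2']⟩

/-- ★★ **THE GROWTH RATE FROM THE DENSITIES**: `μ_1(y,z)² = (4b + 2b_top − 1)(2b + 4b_top − 1)/(1 − 2b − 2b_top)²` for all `y, z > 0`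
(`b = b(y,z)`, `b_top = b(z,y)`; on the diagonal `μ_1(y,y) = (6b − 1)/(1 − 4b)`).
[cite: BeatonBousquetMelouDeGierDuminilCopinGuttmann2014, §3.2 Proposition 6 (arXiv v5 p. 10)] -/
theorem stripMuY₂_one_sq_eq_of_contactB (hy : 0 < y) (hz : 0 < z) :
    stripMuY₂ 1 y z ^ 2 = (4 * contactB y z + 2 * contactB z y - 1) * (2 * contactB y z + 4 * contactB z y - 1) /
      (1 - 2 * contactB y z - 2 * contactB z y) ^ 2 := by
  obtain ⟨t1, t2, t3⟩ := contactB_mem_triangle hy hz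
  have key := (contactB_eosY t1 t2 t3).2.2.2.2.2
  obtain ⟨e1, e2⟩ := eosY_contactB hy hz
  rw [e1, e2] at key
  exact key

/-- ★ On the diagonal: `μ_1(y,y) = (6b − 1)/(1 − 4b)`, `b = b(y,y) ∈ (1/6, 1/4)` — the growth rate of the symmetric two-wall model is a MÖBIUS
function of its contact density. [cite: BeatonBousquetMelouDeGierDuminilCopinGuttmann2014, §3.2 Proposition 6 (arXiv v5 p. 10)] -/
theorem stripMuY₂_one_self_eq_of_contactB (hy : 0 < y) :
    1 / 6 < contactB y y ∧ contactB y y < 1 / 4 ∧ stripMuY₂ 1 y y = (6 * contactB y y - 1) / (1 - 4 * contactB y y) := by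
  obtain ⟨t1, t2, -⟩ := contactB_mem_triangle hy hy
  have hsq := stripMuY₂_one_sq_eq_of_contactB hy hy
  have hμ := stripMuY₂_pos 1 hy hy
  set b := contactB y y
  have hb1 : 1 / 6 < b := by linarith
  have hb2 : b < 1 / 4 := by linarith
  refine ⟨hb1, hb2, ?_⟩
  have hden : 0 < 1 - 4 * b := by linarith
  have hnum : 0 < 6 * b - 1 := by linarith
  have e : (4 * b + 2 * b - 1) * (2 * b + 4 * b - 1) / (1 - 2 * b - 2 * b) ^ 2 = ((6 * b - 1) / (1 - 4 * b)) ^ 2 := by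
    rw [div_pow]; congr 1 <;> ring
  rw [e] at hsq
  have hpos : 0 < (6 * b - 1) / (1 - 4 * b) := div_pos hnum hden
  nlinarith [sq_nonneg (stripMuY₂ 1 y y - (6 * b - 1) / (1 - 4 * b)), sq_nonneg (stripMuY₂ 1 y y + (6 * b - 1) / (1 - 4 * b))]

/-! ## §5 The repelling corner `(y,z) → (0,0)`: domination, the one-third criterion, the parabola scaling, the cluster set `[0, 1/3]` -/

/-- ★★ **DOMINATION**: `ρ(y,z) < (s − y)/s = 1 − α` and `ρ(y,z) < (s − z)/s = 1 − β`; consequently for `z < y`: `ρ(y,z)·y·(y − z) < z`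
(e.g. `ρ(y,z) < 2z/y²` whenever `z ≤ y/2`): a wall that repels LESS than quadratically-less than the other captures the walk and kills the rungs.
[cite: BeatonBousquetMelouDeGierDuminilCopinGuttmann2014, §3.2 Proposition 6 (arXiv v5 p. 10); MadrasSlade1993, §1.1 eq. (1.1.5)] -/
theorem twoWallRho_lt_gap (hy : 0 < y) (hz : 0 < z) :
    twoWallRho y z < (stripMuY₂ 1 y z ^ 2 - y) / stripMuY₂ 1 y z ^ 2 ∧
      twoWallRho y z < (stripMuY₂ 1 y z ^ 2 - z) / stripMuY₂ 1 y z ^ 2 ∧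
      (z < y → twoWallRho y z * (y * (y - z)) < z) := by
  obtain ⟨ha0, ha1, hb0, hb1, h1a, h1b, -⟩ := wallA_facts hy hz
  obtain ⟨hys, hzs⟩ := lt_stripMuY₂_one_sq₂ hy hz
  have hsex := stripMuY₂_one_sq_poly_eq hy hz
  have hρ := twoWallRho_eq_wallA hy hz
  rw [← h1a, ← h1b]
  set s := stripMuY₂ 1 y z ^ 2 with hs
  set a := wallA y z
  set b := wallA z y
  have hs0 : 0 < s := hy.trans hys
  have hD : 0 < 3 - 2 * a - 2 * b + a * b := by nlinarith [mul_pos (sub_pos.2 ha1) (sub_pos.2 hb1)]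
  have hlt1 : twoWallRho y z < 1 - a := by
    rw [hρ, div_lt_iff₀ hD]; nlinarith [mul_pos (sub_pos.2 ha1) (sub_pos.2 hb1), sub_pos.2 ha1]
  have hlt2 : twoWallRho y z < 1 - b := by
    rw [hρ, div_lt_iff₀ hD]; nlinarith [mul_pos (sub_pos.2 ha1) (sub_pos.2 hb1), sub_pos.2 hb1]
  refine ⟨hlt1, hlt2, fun hzy => ?_⟩
  have hyz : 0 < y * (y - z) := mul_pos hy (sub_pos.2 hzy)
  -- `(1 − a)·y(y−z) = (s−y)(y−z)·(y/s) ≤ z·(y/s) < z`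
  have hgap : (s - y) * (y - z) ≤ z := by
    -- `(s−y)·s(s−z) = yz` and `y(y−z) ≤ s(s−z)`
    have h1 : y * (y - z) ≤ s * (s - z) := mul_le_mul hys.le (by linarith) (by linarith) (by linarith)
    have h2 : (s - y) * (y * (y - z)) ≤ (s - y) * (s * (s - z)) := mul_le_mul_of_nonneg_left h1 (by linarith)
    have h3 : (s - y) * (s * (s - z)) = y * z := by linear_combination hsex
    nlinarith
  calc twoWallRho y z * (y * (y - z)) < (1 - a) * (y * (y - z)) := mul_lt_mul_of_pos_right hlt1 hyz
    _ = (s - y) * (y - z) * (y / s) := by rw [h1a]; field_simp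
    _ ≤ z * (y / s) := mul_le_mul_of_nonneg_right hgap (div_pos hy hs0).le
    _ < z := by
      have : y / s < 1 := (div_lt_one hs0).2 hys
      nlinarith

/-- The reciprocal rung density and the size of the wall coordinates: `1/ρ(y,z) = 3 + α/(1−α) + β/(1−β)` with `α³·z ≤ y²` and `β³·y ≤ z²`
(`α = y/s`, `s³ ≥ s(s−y)(s−z) = yz`). [cite: BeatonBousquetMelouDeGierDuminilCopinGuttmann2014, §3.2 Proposition 6 (arXiv v5 p. 10)] -/
theorem inv_twoWallRho_eq (hy : 0 < y) (hz : 0 < z) :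
    1 / twoWallRho y z = 3 + wallA y z / (1 - wallA y z) + wallA z y / (1 - wallA z y) ∧
      wallA y z ^ 3 * z ≤ y ^ 2 ∧ wallA z y ^ 3 * y ≤ z ^ 2 := by
  obtain ⟨hys, hzs⟩ := lt_stripMuY₂_one_sq₂ hy hz
  have hsex := stripMuY₂_one_sq_poly_eq hy hz
  refine ⟨by unfold twoWallRho; rw [one_div_one_div, twoWallM_eq_wallA], ?_, ?_⟩
  · unfold wallA
    set s := stripMuY₂ 1 y z ^ 2 with hs
    have hs0 : 0 < s := hy.trans hys
    rw [div_pow, div_mul_eq_mul_div, div_le_iff₀ (by positivity)]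
    -- `y³ z ≤ y² s³` ⟸ `y z ≤ s³`
    have h3 : y * z ≤ s ^ 3 := by
      rw [← hsex]
      have h1 : s - y ≤ s := by linarith
      have h2 : s - z ≤ s := by linarith
      calc s * (s - y) * (s - z) ≤ s * s * s := mul_le_mul (mul_le_mul_of_nonneg_left h1 hs0.le) h2 (by linarith) (by positivity)
        _ = s ^ 3 := by ring
    nlinarith [pow_pos hy 2]
  · rw [wallA_swap y z]
    set s := stripMuY₂ 1 y z ^ 2 with hs
    have hs0 : 0 < s := hy.trans hys
    rw [div_pow, div_mul_eq_mul_div, div_le_iff₀ (by positivity)]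
    have h3 : y * z ≤ s ^ 3 := by
      rw [← hsex]
      have h1 : s - y ≤ s := by linarith
      have h2 : s - z ≤ s := by linarith
      calc s * (s - y) * (s - z) ≤ s * s * s := mul_le_mul (mul_le_mul_of_nonneg_left h1 hs0.le) h2 (by linarith) (by positivity)
        _ = s ^ 3 := by ring
    nlinarith [pow_pos hz 2]

/-- ★★ **THE ONE-THIRD CRITERION (quantitative)**: if `y² ≤ q₁³ z` and `z² ≤ q₂³ y` with `q₁, q₂ < 1`, then
`0 < 1/ρ(y,z) − 3 ≤ q₁/(1 − q₁) + q₂/(1 − q₂)`.  Hence `ρ → 1/3` whenever `y²/z → 0` and `z²/y → 0` — both walls must repel, and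
neither may repel more than quadratically harder than the other. [cite: BeatonBousquetMelouDeGierDuminilCopinGuttmann2014, §3.2 Proposition 6 (arXiv v5 p. 10); MadrasSlade1993, §1.1 eq. (1.1.5)] -/
theorem inv_twoWallRho_sub_three_le (hy : 0 < y) (hz : 0 < z) {q₁ q₂ : ℝ} (hq₁ : q₁ < 1) (hq₂ : q₂ < 1)
    (h₁ : y ^ 2 ≤ q₁ ^ 3 * z) (h₂ : z ^ 2 ≤ q₂ ^ 3 * y) :
    0 < 1 / twoWallRho y z - 3 ∧ 1 / twoWallRho y z - 3 ≤ q₁ / (1 - q₁) + q₂ / (1 - q₂) := by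
  obtain ⟨ha0, ha1, hb0, hb1, -⟩ := wallA_facts hy hz
  obtain ⟨hinv, hα3, hβ3⟩ := inv_twoWallRho_eq hy hz
  rw [hinv]
  set a := wallA y z
  set b := wallA z y
  have hq₁0 : 0 < q₁ := by
    by_contra h; rw [not_lt] at h
    have : q₁ ^ 3 * z ≤ 0 := mul_nonpos_of_nonpos_of_nonneg (by nlinarith [sq_nonneg q₁]) hz.le
    nlinarith [pow_pos hy 2]
  have hq₂0 : 0 < q₂ := by
    by_contra h; rw [not_lt] at h
    have : q₂ ^ 3 * y ≤ 0 := mul_nonpos_of_nonpos_of_nonneg (by nlinarith [sq_nonneg q₂]) hy.le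
    nlinarith [pow_pos hz 2]
  have haq : a ≤ q₁ := by
    have : a ^ 3 ≤ q₁ ^ 3 := le_of_mul_le_mul_right (by nlinarith) hz
    exact (pow_le_pow_iff_left₀ ha0.le hq₁0.le three_ne_zero).1 this
  have hbq : b ≤ q₂ := by
    have : b ^ 3 ≤ q₂ ^ 3 := le_of_mul_le_mul_right (by nlinarith) hy
    exact (pow_le_pow_iff_left₀ hb0.le hq₂0.le three_ne_zero).1 this
  have m1 : a / (1 - a) ≤ q₁ / (1 - q₁) := by
    rw [div_le_div_iff₀ (sub_pos.2 ha1) (sub_pos.2 hq₁)]; nlinarith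
  have m2 : b / (1 - b) ≤ q₂ / (1 - q₂) := by
    rw [div_le_div_iff₀ (sub_pos.2 hb1) (sub_pos.2 hq₂)]; nlinarith
  have p1 : 0 < a / (1 - a) := div_pos ha0 (sub_pos.2 ha1)
  have p2 : 0 < b / (1 - b) := div_pos hb0 (sub_pos.2 hb1)
  constructor <;> linarith

/-- ★★ **THE ONE-THIRD CRITERION (limit form)**: along any family of positive fugacities with `y²/z → 0` and `z²/y → 0` the rung density
tends to its supremum `1/3` (a rung at every third step). [cite: BeatonBousquetMelouDeGierDuminilCopinGuttmann2014, §3.2 Proposition 6 (arXiv v5 p. 10); MadrasSlade1993, §1.1 eq. (1.1.5)] -/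
theorem tendsto_twoWallRho_one_third {ι : Type*} {l : Filter ι} {f g : ι → ℝ} (hf : ∀ᶠ i in l, 0 < f i) (hg : ∀ᶠ i in l, 0 < g i)
    (h₁ : Tendsto (fun i => f i ^ 2 / g i) l (𝓝 0)) (h₂ : Tendsto (fun i => g i ^ 2 / f i) l (𝓝 0)) :
    Tendsto (fun i => twoWallRho (f i) (g i)) l (𝓝 (1 / 3)) := by
  -- `1/ρ → 3`
  have hM : Tendsto (fun i => 1 / twoWallRho (f i) (g i)) l (𝓝 3) := by
    refine tendsto_order.2 ⟨fun m hm => ?_, fun m hm => ?_⟩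
    · filter_upwards [hf, hg] with i hfi hgi
      have := (inv_twoWallRho_sub_three_le hfi hgi (q₁ := 1 / 2) (q₂ := 1 / 2) (by norm_num) (by norm_num))
      -- positivity part does not need the hypotheses on `q`; use `inv_twoWallRho_eq` directly
      obtain ⟨ha0, ha1, hb0, hb1, -⟩ := wallA_facts hfi hgi
      rw [(inv_twoWallRho_eq hfi hgi).1]
      have p1 : 0 < wallA (f i) (g i) / (1 - wallA (f i) (g i)) := div_pos ha0 (sub_pos.2 ha1)
      have p2 : 0 < wallA (g i) (f i) / (1 - wallA (g i) (f i)) := div_pos hb0 (sub_pos.2 hb1)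
      linarith
    · -- given `m > 3`, take `q ≤ min(1/2, (m−3)/5)`
      set ε := m - 3 with hε
      have hε0 : 0 < ε := by rw [hε]; linarith
      set q := min (1 / 2 : ℝ) (ε / 5) with hq
      have hq0 : 0 < q := lt_min (by norm_num) (by positivity)
      have hq1 : q ≤ 1 / 2 := min_le_left _ _
      have hq2 : q ≤ ε / 5 := min_le_right _ _
      have hq3 : 0 < q ^ 3 := pow_pos hq0 3
      filter_upwards [hf, hg, h₁.eventually (gt_mem_nhds hq3), h₂.eventually (gt_mem_nhds hq3)] with i hfi hgi hi1 hi2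
      have e1 : f i ^ 2 ≤ q ^ 3 * g i := by rw [div_lt_iff₀ hgi] at hi1; exact hi1.le
      have e2 : g i ^ 2 ≤ q ^ 3 * f i := by rw [div_lt_iff₀ hfi] at hi2; exact hi2.le
      have := (inv_twoWallRho_sub_three_le hfi hgi (by linarith) (by linarith) e1 e2).2
      have hqq : q / (1 - q) ≤ 2 * q := by
        rw [div_le_iff₀ (by linarith)]; nlinarith
      linarith
  have h := hM.inv₀ (by norm_num : (3 : ℝ) ≠ 0)
  rw [show ((3 : ℝ))⁻¹ = 1 / 3 by norm_num] at h
  refine h.congr' (Eventually.of_forall fun i => ?_)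
  simp only [one_div, inv_inv]

/-- ★ **Both walls infinitely repelling at the same rate**: `ρ(y,y) → 1/3` as `y → 0⁺` (the diagonal instance of the criterion: `y²/y = y → 0`).
[cite: BeatonBousquetMelouDeGierDuminilCopinGuttmann2014, §3.2 Proposition 6 (arXiv v5 p. 10); MadrasSlade1993, §1.1 eq. (1.1.5)] -/
theorem tendsto_twoWallRho_self_nhdsGT_zero : Tendsto (fun y : ℝ => twoWallRho y y) (𝓝[>] 0) (𝓝 (1 / 3)) := by
  have h0 : Tendsto (fun y : ℝ => y) (𝓝[>] (0 : ℝ)) (𝓝 0) := tendsto_nhdsWithin_of_tendsto_nhds tendsto_id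
  have hpos : ∀ᶠ y in 𝓝[>] (0 : ℝ), 0 < y := self_mem_nhdsWithin
  refine tendsto_twoWallRho_one_third hpos hpos ?_ ?_ <;>
  · refine h0.congr' ?_
    filter_upwards [hpos] with y hy
    rw [pow_two, mul_div_assoc, div_self hy.ne', mul_one]

/-- Along the parabola `z = c·y²` (`c > 0`) the SCALED growth parameter `σ = μ_1(y, cy²)²/y` solves `σ(σ − 1)(σ − cy) = c` with `σ > 1`,
`σ > cy` (the sextic law divided by `y³`: an exact one-parameter scaling, as `u ↦ (yu, zu)` is for rays).
[cite: BeatonBousquetMelouDeGierDuminilCopinGuttmann2014, §3.2 Proposition 6 (arXiv v5 p. 10)] -/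
theorem sigma_parabola_facts {c : ℝ} (hc : 0 < c) (hy : 0 < y) :
    stripMuY₂ 1 y (c * y ^ 2) ^ 2 / y * (stripMuY₂ 1 y (c * y ^ 2) ^ 2 / y - 1) *
        (stripMuY₂ 1 y (c * y ^ 2) ^ 2 / y - c * y) = c ∧
      1 < stripMuY₂ 1 y (c * y ^ 2) ^ 2 / y ∧ c * y < stripMuY₂ 1 y (c * y ^ 2) ^ 2 / y ∧
      twoWallM y (c * y ^ 2) = 3 + (stripMuY₂ 1 y (c * y ^ 2) ^ 2 / y - 1)⁻¹ +
        c * y / (stripMuY₂ 1 y (c * y ^ 2) ^ 2 / y - c * y) := by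
  have hz : 0 < c * y ^ 2 := by positivity
  obtain ⟨hys, hzs⟩ := lt_stripMuY₂_one_sq₂ hy hz
  have hsex := stripMuY₂_one_sq_poly_eq hy hz
  rw [twoWallM_eq_wallA, wallA_swap y (c * y ^ 2)]
  unfold wallA
  set s := stripMuY₂ 1 y (c * y ^ 2) ^ 2 with hs
  have hs0 : 0 < s := hy.trans hys
  have hy0 : y ≠ 0 := hy.ne'
  have hsy : s - y ≠ 0 := by linarith
  have hsz : s - c * y ^ 2 ≠ 0 := by linarith
  have hσ1 : 1 < s / y := by rw [lt_div_iff₀ hy]; linarith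
  have hσc : c * y < s / y := by rw [lt_div_iff₀ hy]; nlinarith
  have hσy : s / y - 1 ≠ 0 := by linarith
  have hσcy : s / y - c * y ≠ 0 := by linarith
  refine ⟨?_, hσ1, hσc, ?_⟩
  · have h3 : y ^ 3 ≠ 0 := pow_ne_zero 3 hy0
    apply mul_left_cancel₀ h3
    have e : y ^ 3 * (s / y * (s / y - 1) * (s / y - c * y)) = s * (s - y) * (s - c * y ^ 2) := by
      field_simp
    rw [e, hsex]; ring
  · have e1 : y / s / (1 - y / s) = (s / y - 1)⁻¹ := by
      rw [inv_eq_one_div]; field_simp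
    have e2 : c * y ^ 2 / s / (1 - c * y ^ 2 / s) = c * y / (s / y - c * y) := by
      field_simp
    rw [e1, e2]

/-- The sandwich along the parabola: with `c = σ₀²(σ₀ − 1)` (`σ₀ > 1`) and `cy < 1`, the scaled growth parameter satisfies
`σ₀ < σ ≤ σ₀ + c²y/(σ₀²(1 − cy))` (lower: `σ²(σ−1) > σ(σ−1)(σ−cy) = c = σ₀²(σ₀−1)`; upper: `σ²(σ−1)(1−cy) ≤ c` and `σ²(σ−1) − σ₀²(σ₀−1) ≥ σ₀²(σ−σ₀)`).
[cite: BeatonBousquetMelouDeGierDuminilCopinGuttmann2014, §3.2 Proposition 6 (arXiv v5 p. 10) (lane plumbing)] -/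
theorem sigma_parabola_sandwich {σ₀ : ℝ} (hσ₀ : 1 < σ₀) (hy : 0 < y) (hyc : σ₀ ^ 2 * (σ₀ - 1) * y < 1) :
    σ₀ < stripMuY₂ 1 y (σ₀ ^ 2 * (σ₀ - 1) * y ^ 2) ^ 2 / y ∧
      stripMuY₂ 1 y (σ₀ ^ 2 * (σ₀ - 1) * y ^ 2) ^ 2 / y - σ₀ ≤
        (σ₀ ^ 2 * (σ₀ - 1)) ^ 2 * y / (σ₀ ^ 2 * (1 - σ₀ ^ 2 * (σ₀ - 1) * y)) := by
  set c := σ₀ ^ 2 * (σ₀ - 1) with hc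
  have hc0 : 0 < c := by rw [hc]; exact mul_pos (by positivity) (by linarith)
  obtain ⟨hcub, hσ1, hσc, -⟩ := sigma_parabola_facts hc0 hy
  set σ := stripMuY₂ 1 y (c * y ^ 2) ^ 2 / y with hσ
  have hσ0 : 0 < σ := by linarith
  have hcy : 0 < c * y := mul_pos hc0 hy
  -- lower bound
  have hkey : c < σ ^ 2 * (σ - 1) := by
    rw [← hcub]
    have h1 : σ - c * y < σ := by linarith
    have h2 : 0 < σ * (σ - 1) := mul_pos hσ0 (by linarith)
    nlinarith [mul_lt_mul_of_pos_left h1 h2]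
  have hlow : σ₀ < σ := by
    by_contra hle
    rw [not_lt] at hle
    rcases hle.lt_or_eq with hlt | heq
    · have := poly_lt_poly_of_lt (y := 1) (z := 0) (a := σ) (b := σ₀) (by
        rw [max_eq_left zero_le_one]; exact hσ1.le) hlt one_pos
      have e1 : σ * (σ - 1) * (σ - 0) = σ ^ 2 * (σ - 1) := by ring
      have e2 : σ₀ * (σ₀ - 1) * (σ₀ - 0) = c := by rw [hc]; ring
      rw [e1, e2] at this
      linarith
    · rw [heq] at hkey; rw [hc] at hkey; linarith
  refine ⟨hlow, ?_⟩
  -- upper bound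
  have h1 : σ * (1 - c * y) ≤ σ - c * y := by nlinarith
  have h2 : σ ^ 2 * (σ - 1) * (1 - c * y) ≤ c := by
    have hnn : 0 ≤ σ * (σ - 1) := by nlinarith
    calc σ ^ 2 * (σ - 1) * (1 - c * y) = σ * (σ - 1) * (σ * (1 - c * y)) := by ring
      _ ≤ σ * (σ - 1) * (σ - c * y) := mul_le_mul_of_nonneg_left h1 hnn
      _ = c := hcub
  have h3 : σ₀ ^ 2 * (σ - σ₀) ≤ σ ^ 2 * (σ - 1) - c := by
    rw [hc]
    have : σ₀ ^ 2 ≤ σ ^ 2 := pow_le_pow_left₀ (by linarith) hlow.le 2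
    nlinarith
  have hcy1 : 0 < 1 - c * y := by linarith
  have hden : 0 < σ₀ ^ 2 * (1 - c * y) := mul_pos (by positivity) hcy1
  rw [le_div_iff₀ hden]
  have h4 : σ₀ ^ 2 * (σ - σ₀) * (1 - c * y) ≤ (σ ^ 2 * (σ - 1) - c) * (1 - c * y) :=
    mul_le_mul_of_nonneg_right h3 hcy1.le
  nlinarith

/-- ★★ **The scaled growth parameter along the parabola converges**: `μ_1(y, σ₀²(σ₀−1)·y²)²/y → σ₀` as `y → 0⁺`, every `σ₀ > 1`.
[cite: BeatonBousquetMelouDeGierDuminilCopinGuttmann2014, §3.2 Proposition 6 (arXiv v5 p. 10)] -/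
theorem tendsto_sigma_parabola {σ₀ : ℝ} (hσ₀ : 1 < σ₀) :
    Tendsto (fun y => stripMuY₂ 1 y (σ₀ ^ 2 * (σ₀ - 1) * y ^ 2) ^ 2 / y) (𝓝[>] 0) (𝓝 σ₀) := by
  set c := σ₀ ^ 2 * (σ₀ - 1) with hc
  have hc0 : 0 < c := by rw [hc]; exact mul_pos (by positivity) (by linarith)
  have h0 : Tendsto (fun y : ℝ => y) (𝓝[>] (0 : ℝ)) (𝓝 0) := tendsto_nhdsWithin_of_tendsto_nhds tendsto_id
  have hu : Tendsto (fun y : ℝ => σ₀ + c ^ 2 * y / (σ₀ ^ 2 * (1 - c * y))) (𝓝[>] 0)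
      (𝓝 (σ₀ + c ^ 2 * 0 / (σ₀ ^ 2 * (1 - c * 0)))) :=
    tendsto_const_nhds.add ((tendsto_const_nhds.mul h0).div
      (tendsto_const_nhds.mul (tendsto_const_nhds.sub (tendsto_const_nhds.mul h0))) (by simp; positivity))
  have e : σ₀ + c ^ 2 * 0 / (σ₀ ^ 2 * (1 - c * 0)) = σ₀ := by simp
  rw [e] at hu
  have hev : ∀ᶠ y in 𝓝[>] (0 : ℝ), 0 < y ∧ c * y < 1 := by
    have : Set.Ioo (0 : ℝ) (1 / c) ∈ 𝓝[>] (0 : ℝ) := Ioo_mem_nhdsGT (by positivity)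
    filter_upwards [this] with y hy
    exact ⟨hy.1, by have := hy.2; rwa [lt_div_iff₀ hc0, mul_comm] at this⟩
  refine tendsto_of_tendsto_of_tendsto_of_le_of_le' tendsto_const_nhds hu ?_ ?_
  · filter_upwards [hev] with y hy
    exact (sigma_parabola_sandwich hσ₀ hy.1 hy.2).1.le
  · filter_upwards [hev] with y hy
    have := (sigma_parabola_sandwich hσ₀ hy.1 hy.2).2
    linarith

/-- ★★★ **THE PARABOLA SCALING OF THE REPELLING CORNER**: for every `σ₀ > 1`, along `z = σ₀²(σ₀−1)·y²`,
`ρ(y, z) → (σ₀ − 1)/(3σ₀ − 2)` as `y → 0⁺` (`1/ρ = 3 + 1/(σ−1) + cy/(σ−cy) → 3 + 1/(σ₀−1)`).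
[cite: BeatonBousquetMelouDeGierDuminilCopinGuttmann2014, §3.2 Proposition 6 (arXiv v5 p. 10); MadrasSlade1993, §1.1 eq. (1.1.5)] -/
theorem tendsto_twoWallRho_parabola' {σ₀ : ℝ} (hσ₀ : 1 < σ₀) :
    Tendsto (fun y => twoWallRho y (σ₀ ^ 2 * (σ₀ - 1) * y ^ 2)) (𝓝[>] 0) (𝓝 ((σ₀ - 1) / (3 * σ₀ - 2))) := by
  set c := σ₀ ^ 2 * (σ₀ - 1) with hc
  have hc0 : 0 < c := by rw [hc]; exact mul_pos (by positivity) (by linarith)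
  have hσ := tendsto_sigma_parabola hσ₀
  have h0 : Tendsto (fun y : ℝ => y) (𝓝[>] (0 : ℝ)) (𝓝 0) := tendsto_nhdsWithin_of_tendsto_nhds tendsto_id
  have hM : Tendsto (fun y => 3 + (stripMuY₂ 1 y (c * y ^ 2) ^ 2 / y - 1)⁻¹ +
      c * y / (stripMuY₂ 1 y (c * y ^ 2) ^ 2 / y - c * y)) (𝓝[>] 0) (𝓝 (3 + (σ₀ - 1)⁻¹ + c * 0 / (σ₀ - c * 0))) :=
    (tendsto_const_nhds.add ((hσ.sub_const 1).inv₀ (sub_ne_zero.2 hσ₀.ne'))).add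
      ((tendsto_const_nhds.mul h0).div (hσ.sub (tendsto_const_nhds.mul h0)) (by simp; linarith))
  have e : (3 : ℝ) + (σ₀ - 1)⁻¹ + c * 0 / (σ₀ - c * 0) = 3 + (σ₀ - 1)⁻¹ := by simp
  rw [e] at hM
  have hne : (3 : ℝ) + (σ₀ - 1)⁻¹ ≠ 0 := by
    have : 0 < (σ₀ - 1)⁻¹ := inv_pos.2 (by linarith)
    linarith
  have hρ : Tendsto (fun y => 1 / (3 + (stripMuY₂ 1 y (c * y ^ 2) ^ 2 / y - 1)⁻¹ +
      c * y / (stripMuY₂ 1 y (c * y ^ 2) ^ 2 / y - c * y))) (𝓝[>] 0) (𝓝 (1 / (3 + (σ₀ - 1)⁻¹))) :=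
    tendsto_const_nhds.div hM hne
  have e2 : (1 : ℝ) / (3 + (σ₀ - 1)⁻¹) = (σ₀ - 1) / (3 * σ₀ - 2) := by
    have h1 : σ₀ - 1 ≠ 0 := by linarith
    have h2 : 3 * σ₀ - 2 ≠ 0 := by linarith
    rw [div_eq_div_iff hne h2, one_mul, mul_add, mul_inv_cancel₀ h1]; ring
  rw [e2] at hρ
  refine hρ.congr' ?_
  filter_upwards [self_mem_nhdsWithin] with y hy
  have hy : (0 : ℝ) < y := hy
  rw [← (sigma_parabola_facts hc0 hy).2.2.2]
  rfl

/-- ★★★ **EVERY RUNG DENSITY IN `(0, 1/3)` IS A CORNER LIMIT, ALONG EXACTLY ONE PARABOLA**: for `0 < r < 1/3`, with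
`c_r = r(1 − 2r)²/(1 − 3r)³`, `ρ(y, c_r·y²) → r` as `y → 0⁺` (`σ₀ = (1−2r)/(1−3r)`; `c ↦ lim ρ` is the increasing bijection
`(0,∞) → (0,1/3)`, `c = 100 ↦ 4/13`).  So the two-wall rung density has NO limit at the repelling corner `(0⁺,0⁺)`: the threshold
exponent is `2` (`z ≪ y²`: `ρ → 0` by `twoWallRho_lt_gap`; `y² ≪ z` and `z² ≪ y`: `ρ → 1/3` by `tendsto_twoWallRho_one_third`).
[cite: BeatonBousquetMelouDeGierDuminilCopinGuttmann2014, §3.2 Proposition 6 (arXiv v5 p. 10); MadrasSlade1993, §1.1 eq. (1.1.5)] -/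
theorem tendsto_twoWallRho_parabola {r : ℝ} (hr0 : 0 < r) (hr1 : r < 1 / 3) :
    Tendsto (fun y => twoWallRho y (r * (1 - 2 * r) ^ 2 / (1 - 3 * r) ^ 3 * y ^ 2)) (𝓝[>] 0) (𝓝 r) := by
  have h3 : 0 < 1 - 3 * r := by linarith
  set t := 1 - 3 * r with ht
  have ht0 : t ≠ 0 := h3.ne'
  set σ₀ := (1 - 2 * r) / t with hσ₀
  have hσ₀1 : 1 < σ₀ := by rw [hσ₀, lt_div_iff₀ h3]; linarith
  have h := tendsto_twoWallRho_parabola' hσ₀1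
  have ea : σ₀ - 1 = r / t := by
    rw [hσ₀, eq_div_iff ht0, sub_mul, div_mul_cancel₀ _ ht0, ht]; ring
  have eb : 3 * σ₀ - 2 = 1 / t := by
    rw [hσ₀, eq_div_iff ht0, sub_mul, mul_assoc, div_mul_cancel₀ _ ht0, ht]; ring
  have e1 : σ₀ ^ 2 * (σ₀ - 1) = r * (1 - 2 * r) ^ 2 / t ^ 3 := by
    rw [ea, hσ₀, div_pow, div_mul_div_comm, ← pow_succ]
    congr 1; ring
  have e2 : (σ₀ - 1) / (3 * σ₀ - 2) = r := by
    rw [ea, eb, div_div_div_cancel_right₀ ht0, div_one]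
  rw [e1, e2] at h
  exact h

/-- ★★ **THE CLUSTER SET OF THE RUNG DENSITY AT THE REPELLING CORNER IS ALL OF `[0, 1/3]`**: for every `0 ≤ r ≤ 1/3` there is a
path `z = g(y) > 0`, `g(y) → 0`, with `ρ(y, g(y)) → r` as `y → 0⁺` (`g = y³` for `r = 0`, the parabola `c_r y²` for `0 < r < 1/3`, the
diagonal `g = y` for `r = 1/3`). [cite: BeatonBousquetMelouDeGierDuminilCopinGuttmann2014, §3.2 Proposition 6 (arXiv v5 p. 10); MadrasSlade1993, §1.1 eq. (1.1.5)] -/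
theorem exists_path_tendsto_twoWallRho {r : ℝ} (hr0 : 0 ≤ r) (hr1 : r ≤ 1 / 3) :
    ∃ g : ℝ → ℝ, (∀ y, 0 < y → 0 < g y) ∧ Tendsto g (𝓝[>] 0) (𝓝 0) ∧
      Tendsto (fun y => twoWallRho y (g y)) (𝓝[>] 0) (𝓝 r) := by
  have h0 : Tendsto (fun y : ℝ => y) (𝓝[>] (0 : ℝ)) (𝓝 0) := tendsto_nhdsWithin_of_tendsto_nhds tendsto_id
  have hpos : ∀ᶠ y in 𝓝[>] (0 : ℝ), 0 < y := self_mem_nhdsWithin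
  rcases hr0.lt_or_eq with hr0' | hr0'
  · rcases hr1.lt_or_eq with hr1' | hr1'
    · -- the parabola
      have h3r : 0 < 1 - 3 * r := by linarith
      have h2r : 0 < 1 - 2 * r := by linarith
      have hc : 0 < r * (1 - 2 * r) ^ 2 / (1 - 3 * r) ^ 3 := div_pos (mul_pos hr0' (pow_pos h2r 2)) (pow_pos h3r 3)
      refine ⟨fun y => r * (1 - 2 * r) ^ 2 / (1 - 3 * r) ^ 3 * y ^ 2, fun y hy => mul_pos hc (pow_pos hy 2), ?_,
        tendsto_twoWallRho_parabola hr0' hr1'⟩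
      have := (h0.pow 2).const_mul (r * (1 - 2 * r) ^ 2 / (1 - 3 * r) ^ 3)
      rw [zero_pow two_ne_zero, mul_zero] at this
      exact this
    · -- the diagonal
      refine ⟨fun y => y, fun y hy => hy, h0, ?_⟩
      rw [hr1']; exact tendsto_twoWallRho_self_nhdsGT_zero
  · -- the cubic `z = y³`: `0 < ρ(y,y³) < y/(1 − y²)`
    have hcube : Tendsto (fun y : ℝ => y ^ 3) (𝓝[>] (0 : ℝ)) (𝓝 0) := by
      have := h0.pow 3
      rw [zero_pow three_ne_zero] at this
      exact this
    refine ⟨fun y => y ^ 3, fun y hy => pow_pos hy 3, hcube, ?_⟩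
    rw [← hr0']
    have hup : Tendsto (fun y : ℝ => y / (1 - y ^ 2)) (𝓝[>] (0 : ℝ)) (𝓝 0) := by
      have hsq : Tendsto (fun y : ℝ => 1 - y ^ 2) (𝓝[>] (0 : ℝ)) (𝓝 1) := by
        have : Tendsto (fun y : ℝ => 1 - y ^ 2) (𝓝[>] (0 : ℝ)) (𝓝 (1 - 0 ^ 2)) := tendsto_const_nhds.sub (h0.pow 2)
        rw [zero_pow two_ne_zero, sub_zero] at this
        exact this
      have := h0.div hsq one_ne_zero
      rw [zero_div] at this
      exact this
    have hev : ∀ᶠ y in 𝓝[>] (0 : ℝ), 0 < y ∧ y < 1 := by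
      have : Set.Ioo (0 : ℝ) 1 ∈ 𝓝[>] (0 : ℝ) := Ioo_mem_nhdsGT one_pos
      filter_upwards [this] with y hy using hy
    refine tendsto_of_tendsto_of_tendsto_of_le_of_le' tendsto_const_nhds hup ?_ ?_
    · filter_upwards [hev] with y hy
      have := (twoWallSpeed_mem_Ioo hy.1 (pow_pos hy.1 3)).2
      unfold twoWallSpeed at this
      linarith
    · filter_upwards [hev] with y hy
      have hy3 : y ^ 3 < y := by nlinarith [pow_pos hy.1 2, pow_pos hy.1 3]
      have h := (twoWallRho_lt_gap hy.1 (pow_pos hy.1 3)).2.2 hy3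
      have hden : 0 < 1 - y ^ 2 := by nlinarith
      rw [le_div_iff₀ hden]
      have e : y * (y - y ^ 3) = y ^ 2 * (1 - y ^ 2) := by ring
      rw [e] at h
      nlinarith [pow_pos hy.1 2]

/-- ★★ **NO LIMIT AT THE CORNER**: the rung density `ρ` (equivalently the speed `v = 1 − ρ`, the contact densities) of the two-wall
strip walk does not extend continuously to the repelling corner of the closed quadrant: there is no `L` with `ρ(y,z) → L` as
`(y,z) → (0,0)` within `(0,∞)²`. [cite: BeatonBousquetMelouDeGierDuminilCopinGuttmann2014, §3.2 Proposition 6 (arXiv v5 p. 10); MadrasSlade1993, §1.1 eq. (1.1.5)] -/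
theorem not_tendsto_twoWallRho_corner (L : ℝ) :
    ¬ Tendsto (fun p : ℝ × ℝ => twoWallRho p.1 p.2) (𝓝[Set.Ioi 0 ×ˢ Set.Ioi 0] (0, 0)) (𝓝 L) := by
  intro hL
  -- two paths into the corner
  have hpath : ∀ g : ℝ → ℝ, (∀ y, 0 < y → 0 < g y) → Tendsto g (𝓝[>] 0) (𝓝 0) →
      Tendsto (fun y => twoWallRho y (g y)) (𝓝[>] 0) (𝓝 L) := by
    intro g hg hg0
    have hp : Tendsto (fun y : ℝ => (y, g y)) (𝓝[>] 0) (𝓝[Set.Ioi 0 ×ˢ Set.Ioi 0] ((0 : ℝ), (0 : ℝ))) := by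
      refine tendsto_nhdsWithin_iff.2 ⟨?_, ?_⟩
      · exact (tendsto_nhdsWithin_of_tendsto_nhds tendsto_id).prodMk_nhds hg0
      · filter_upwards [self_mem_nhdsWithin] with y hy
        exact ⟨hy, hg y hy⟩
    refine (hL.comp hp).congr (fun y => ?_)
    simp only [Function.comp_apply]
  obtain ⟨g₁, hg₁, hg₁0, h₁⟩ := exists_path_tendsto_twoWallRho (r := 0) le_rfl (by norm_num)
  obtain ⟨g₂, hg₂, hg₂0, h₂⟩ := exists_path_tendsto_twoWallRho (r := 1 / 3) (by norm_num) le_rfl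
  have e₁ := tendsto_nhds_unique (hpath g₁ hg₁ hg₁0) h₁
  have e₂ := tendsto_nhds_unique (hpath g₂ hg₂ hg₂0) h₂
  rw [e₁] at e₂
  norm_num at e₂

end Literature.Probability.RandomPlanarGeometry.SAW.HexBW
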